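import Mathlib
import Summits.Ventures.PercRepro2.TypedBlockFibre

/-!
# The block-transfer rule of the typed equality locus (blind cell PercRepro2, mine-2 g37, 2026-08-28;
`proofs/MINE2-FIBRE.md` §1b, row M2-77)

The general form of the b-transfer rule (`TypedFibreTransfer.lean`): on a fibre (forced-open `z`,
split set `S`) let `W` be a vertex block with the roots outside it, no vertex of `W` attached to a root
through `z`, and every edge of the fibre graph leaving `W` ending at a vertex attached to a root
through `z` (`BlockData`).  Exchanging between the two complementary copies the split edges touching
`W` (`flipOn (splitTouch W S)`) preserves `Q` in both copies and the connectivity of the vertices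
outside `W`, and exchanges the sides of the vertices of `W` (`transferW`).  Hence the complementary-pair
count of `1_Q(y) 1_Q(w) (X(w) − X(y)) (Y(w) − Y(y))` vanishes for every `W`-blind `X` (a function of
the connectivity outside `W`) and `W`-side `Y` (a function of the sides of the vertices of `W`)
(`pinnedCount_blockTransfer_eq_zero`); the instances are `X = σ_o − σ₃ u_o, Y = σ_b` for the block of
`b`, and `X = σ_b, Y = σ_o − σ₃ u_o` for the block of `o` containing `a₃`.

Own code; standard axioms.
-/

namespace Summit.Ventures.PercRepro2

open UnionCluster

namespace CovForm

namespace BlockTransfer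

section Main

open Classical

variable {V : Type*} {E : Type*} [Fintype E] [DecidableEq E] {R : Type*} [Field R]
variable {ends : E → Sym2 V} {a₁ a₂ : V} {W : Finset V}

/-! ## The transfer -/

omit [Fintype E] in
/-- Off the edges touching `W`, the exchange changes nothing. -/
lemma flip_splitTouch_of_not {S : Finset E} (y : Config E) {e : E} (h : ¬ touchesW ends W e) :
    flipOn (splitTouch ends W S) y e = y e :=
  flipOn_of_notMem _ _ (fun he => h (mem_splitTouch.1 he).2)

omit [Fintype E] in
/-- On the edges touching `W`, the exchange gives the complementary copy. -/
lemma flip_splitTouch_of_touch {S : Finset E} (y : Config E) {e : E} (h : touchesW ends W e) :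
    flipOn (splitTouch ends W S) y e = flipOn S y e := by
  by_cases hS : e ∈ S
  · rw [flipOn_of_mem _ _ (mem_splitTouch.2 ⟨hS, h⟩), flipOn_of_mem _ _ hS]
  · rw [flipOn_of_notMem _ _ (fun he => hS (mem_splitTouch.1 he).1), flipOn_of_notMem _ _ hS]

omit [Fintype E] in
/-- The exchange commutes with the complementation on `S`. -/
lemma flip_splitTouch_comm (S : Finset E) (y : Config E) :
    flipOn S (flipOn (splitTouch ends W S) y) = flipOn (splitTouch ends W S) (flipOn S y) := by
  funext e
  by_cases hS : e ∈ S <;> by_cases ht : e ∈ splitTouch ends W S <;> simp [flipOn, hS, ht]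

omit [Fintype E] in
/-- `flipOn G` is an involution. -/
lemma flipOn_self' (G : Finset E) (y : Config E) : flipOn G (flipOn G y) = y := by
  funext e
  by_cases h : e ∈ G <;> simp [flipOn, h]

omit [Fintype E] in
/-- A copy of the fibre stays in the fibre under the exchange and under complementation. -/
lemma agree_of_agree {S : Finset E} {z : Config E} (y : Config E) (hy : ∀ e, e ∉ S → y e = z e) :
    (∀ e, e ∉ S → flipOn (splitTouch ends W S) y e = z e) ∧ (∀ e, e ∉ S → flipOn S y e = z e) := by
  constructor
  · intro e he
    rw [flipOn_of_notMem _ _ (fun h => he (mem_splitTouch.1 h).1)]; exact hy e he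
  · intro e he
    rw [flipOn_of_notMem _ _ he]; exact hy e he

omit [Fintype E] in
/-- **The transfer step**: on a pair `(y, w)` of the fibre with `Q` in both copies, the exchange
`y' = flipOn (splitTouch W S) y` has the connectivity of `y` outside `W` and the sides of `w` on `W`. -/
lemma transferW {S : Finset E} {z : Config E} (hd : BlockData ends a₁ a₂ W S z) (y : Config E)
    (hy : ∀ e, e ∉ S → y e = z e) (hQy : ¬ Conn ends y a₂ a₁)
    (hQw : ¬ Conn ends (flipOn S y) a₂ a₁) :
    (∀ u v, u ∉ W → v ∉ W →
      (Conn ends (flipOn (splitTouch ends W S) y) u v ↔ Conn ends y u v)) ∧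
    (∀ v ∈ W, (Conn ends (flipOn (splitTouch ends W S) y) a₁ v ↔ Conn ends (flipOn S y) a₁ v) ∧
      (Conn ends (flipOn (splitTouch ends W S) y) a₂ v ↔ Conn ends (flipOn S y) a₂ v)) := by
  obtain ⟨hy'_agree, hw_agree⟩ := agree_of_agree (ends := ends) (W := W) y hy
  -- `y'` and `w` agree on the edges touching `W`; `y'` and `y` off them
  have hy'w : ∀ e, touchesW ends W e → flipOn (splitTouch ends W S) y e = flipOn S y e :=
    fun e he => flip_splitTouch_of_touch y he
  have hy'y : ∀ e, ¬ touchesW ends W e → flipOn (splitTouch ends W S) y e = y e :=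
    fun e he => flip_splitTouch_of_not y he
  have hclose : closeAtW ends W (flipOn (splitTouch ends W S) y) = closeAtW ends W y :=
    closeAtW_eq_of_agree ends W hy'y
  have hwithin : withinW ends W (flipOn (splitTouch ends W S) y) = withinW ends W (flipOn S y) :=
    withinW_eq_of_agree ends W hy'w
  -- the attachment hypothesis of `y'`, inherited from `w`
  have Hw := hd.attached _ hw_agree hQw
  have Hy' : Attached ends W (flipOn (splitTouch ends W S) y) (closeAtW ends W z) := by
    intro e e' he he' x z₁ x' z' hends hends' hxW hz₁W hx'W hz'W hxx'
    rw [hy'w e (touchesW_of_mem ends W hends hxW)] at he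
    rw [hy'w e' (touchesW_of_mem ends W hends' hx'W)] at he'
    rw [hwithin] at hxx'
    exact Hw e e' he he' x z₁ x' z' hends hends' hxW hz₁W hx'W hz'W hxx'
  have hc : ∀ u v, u ∉ W → v ∉ W →
      (Conn ends (flipOn (splitTouch ends W S) y) u v ↔ Conn ends y u v) := by
    intro u v hu hv
    rw [conn_iff_closeAtW ends W _ _ (hd.base_le _ hy'_agree) Hy' hu hv,
      conn_iff_closeAtW ends W y _ (hd.base_le y hy) (hd.attached y hy hQy) hu hv, hclose]
  refine ⟨hc, fun v hv => ?_⟩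
  have hQy' : ¬ Conn ends (flipOn (splitTouch ends W S) y) a₂ a₁ := by
    rw [hc a₂ a₁ hd.a₂W hd.a₁W]; exact hQy
  have key : ∀ r, r = a₁ ∨ r = a₂ →
      (Conn ends (flipOn (splitTouch ends W S) y) r v ↔ Conn ends (flipOn S y) r v) := by
    intro r hr
    rw [hd.conn_side_iff _ hy'_agree hQy' hr hv, hd.conn_side_iff _ hw_agree hQw hr hv, hwithin]
    constructor
    · rintro ⟨x, hxW, hxv, e, he, z₁, hz₁W, hends, hz₁⟩
      exact ⟨x, hxW, hxv, e, by rw [← hy'w e (touchesW_of_mem ends W hends hxW)]; exact he, z₁, hz₁W,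
        hends, hz₁⟩
    · rintro ⟨x, hxW, hxv, e, he, z₁, hz₁W, hends, hz₁⟩
      exact ⟨x, hxW, hxv, e, by rw [hy'w e (touchesW_of_mem ends W hends hxW)]; exact he, z₁, hz₁W,
        hends, hz₁⟩
  exact ⟨key a₁ (Or.inl rfl), key a₂ (Or.inr rfl)⟩

omit [Fintype E] [DecidableEq E] in
/-- `1_Q` as a decided indicator. -/
lemma iQ_eq_ite' (ω : Config E) :
    (iQ ends a₁ a₂ ω : R) = if Conn ends ω a₂ a₁ then 0 else 1 := by
  unfold iQ
  simp only [Set.indicator_apply, mem_avoidAll, Finset.mem_singleton, forall_eq, Pi.one_apply]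
  by_cases h : Conn ends ω a₂ a₁ <;> simp [h]

omit [Fintype E] in
/-- With `Q` in both copies, the exchange negates the block covariance term. -/
lemma covW_flip_of_Q {S : Finset E} {z : Config E} (hd : BlockData ends a₁ a₂ W S z)
    {X Y : Config E → R} (hX : WBlind ends W X) (hY : WSide ends a₁ a₂ W Y) (y : Config E)
    (hy : ∀ e, e ∉ S → y e = z e) (hQy : ¬ Conn ends y a₂ a₁)
    (hQw : ¬ Conn ends (flipOn S y) a₂ a₁) :
    covW ends a₁ a₂ X Y (flipOn (splitTouch ends W S) y)
        (flipOn (splitTouch ends W S) (flipOn S y)) =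
      - covW ends a₁ a₂ X Y y (flipOn S y) := by
  obtain ⟨hc, hs⟩ := transferW hd y hy hQy hQw
  obtain ⟨-, hw_agree⟩ := agree_of_agree (ends := ends) (W := W) y hy
  have hyy : flipOn S (flipOn S y) = y := flipOn_self' S y
  obtain ⟨hc', hs'⟩ := transferW hd (flipOn S y) hw_agree hQw (by rw [hyy]; exact hQy)
  rw [hyy] at hs'
  have hQy' : ¬ Conn ends (flipOn (splitTouch ends W S) y) a₂ a₁ := by
    rw [hc a₂ a₁ hd.a₂W hd.a₁W]; exact hQy
  have hQw' : ¬ Conn ends (flipOn (splitTouch ends W S) (flipOn S y)) a₂ a₁ := by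
    rw [hc' a₂ a₁ hd.a₂W hd.a₁W]; exact hQw
  have hXy := hX _ _ hc
  have hXw := hX _ _ hc'
  have hYy := hY _ _ hs
  have hYw := hY _ _ hs'
  unfold covW
  rw [iQ_eq_ite', iQ_eq_ite', iQ_eq_ite', iQ_eq_ite', hXy, hXw, hYy, hYw, if_neg hQy, if_neg hQw,
    if_neg hQy', if_neg hQw']
  ring

omit [Fintype E] in
/-- Without `Q` in both copies the term vanishes, before and after the exchange. -/
lemma covW_eq_zero_of_not_Q {S : Finset E} {z : Config E} (hd : BlockData ends a₁ a₂ W S z)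
    (X Y : Config E → R) (y : Config E) (hy : ∀ e, e ∉ S → y e = z e)
    (hQ : ¬ (¬ Conn ends y a₂ a₁ ∧ ¬ Conn ends (flipOn S y) a₂ a₁)) :
    covW ends a₁ a₂ X Y y (flipOn S y) = 0 ∧
      covW ends a₁ a₂ X Y (flipOn (splitTouch ends W S) y)
        (flipOn (splitTouch ends W S) (flipOn S y)) = 0 := by
  have hor : Conn ends y a₂ a₁ ∨ Conn ends (flipOn S y) a₂ a₁ := by
    by_contra h
    exact hQ ⟨fun ha => h (Or.inl ha), fun hb => h (Or.inr hb)⟩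
  constructor
  · unfold covW
    rcases hor with h | h <;> simp [iQ_eq_ite', h]
  · by_cases hQy' : Conn ends (flipOn (splitTouch ends W S) y) a₂ a₁
    · unfold covW; simp [iQ_eq_ite', hQy']
    by_cases hQw' : Conn ends (flipOn (splitTouch ends W S) (flipOn S y)) a₂ a₁
    · unfold covW; simp [iQ_eq_ite', hQw']
    exfalso
    obtain ⟨hy'_agree, hw_agree⟩ := agree_of_agree (ends := ends) (W := W) y hy
    have hflip : flipOn S (flipOn (splitTouch ends W S) y) =
        flipOn (splitTouch ends W S) (flipOn S y) := flip_splitTouch_comm S y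
    obtain ⟨hc, -⟩ := transferW hd (flipOn (splitTouch ends W S) y) hy'_agree hQy'
      (by rw [hflip]; exact hQw')
    rw [flipOn_self'] at hc
    obtain ⟨hc', -⟩ := transferW hd (flipOn (splitTouch ends W S) (flipOn S y))
      (agree_of_agree (ends := ends) (W := W) _ hw_agree).1 hQw' (by rw [← hflip, flipOn_self']; exact hQy')
    rw [flipOn_self'] at hc'
    rcases hor with h | h
    · exact hQy' ((hc a₂ a₁ hd.a₂W hd.a₁W).1 h)
    · exact hQw' ((hc' a₂ a₁ hd.a₂W hd.a₁W).1 h)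

/-- **The block-transfer rule**: on a fibre with a block `W`, the complementary-pair count of the
covariance of a `W`-blind `X` against a `W`-side `Y` vanishes. -/
theorem pinnedCount_blockTransfer_eq_zero {S : Finset E} {z : Config E}
    (hd : BlockData ends a₁ a₂ W S z) {X Y : Config E → R} (hX : WBlind ends W X)
    (hY : WSide ends a₁ a₂ W Y) :
    pinnedCount S z (covW ends a₁ a₂ X Y) = 0 := by
  by_cases hT : splitTouch ends W S = ∅
  · -- no split edge touches `W`: the sides of `W` agree in the two copies and the term vanishes
    unfold pinnedCount
    refine Finset.sum_eq_zero fun y _ => ?_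
    split_ifs with hy
    · obtain ⟨-, hw_agree⟩ := agree_of_agree (ends := ends) (W := W) y hy
      by_cases hQ : ¬ Conn ends y a₂ a₁ ∧ ¬ Conn ends (flipOn S y) a₂ a₁
      · have hagree : ∀ e, touchesW ends W e → y e = flipOn S y e := by
          intro e he
          by_cases hS : e ∈ S
          · exact absurd (mem_splitTouch.2 ⟨hS, he⟩) (by rw [hT]; exact Finset.notMem_empty e)
          · rw [flipOn_of_notMem _ _ hS]
        have hwithin : withinW ends W y = withinW ends W (flipOn S y) := withinW_eq_of_agree ends W hagree
        have hside : ∀ v ∈ W, (Conn ends y a₁ v ↔ Conn ends (flipOn S y) a₁ v) ∧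
            (Conn ends y a₂ v ↔ Conn ends (flipOn S y) a₂ v) := by
          intro v hv
          have key : ∀ r, r = a₁ ∨ r = a₂ → (Conn ends y r v ↔ Conn ends (flipOn S y) r v) := by
            intro r hr
            rw [hd.conn_side_iff y hy hQ.1 hr hv, hd.conn_side_iff _ hw_agree hQ.2 hr hv, hwithin]
            constructor
            · rintro ⟨x, hxW, hxv, e, he, z₁, hz₁W, hends, hz₁⟩
              exact ⟨x, hxW, hxv, e, by rw [← hagree e (touchesW_of_mem ends W hends hxW)]; exact he,
                z₁, hz₁W, hends, hz₁⟩
            · rintro ⟨x, hxW, hxv, e, he, z₁, hz₁W, hends, hz₁⟩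
              exact ⟨x, hxW, hxv, e, by rw [hagree e (touchesW_of_mem ends W hends hxW)]; exact he,
                z₁, hz₁W, hends, hz₁⟩
          exact ⟨key a₁ (Or.inl rfl), key a₂ (Or.inr rfl)⟩
        unfold covW
        rw [hY _ _ hside]; ring
      · exact (covW_eq_zero_of_not_Q hd X Y y hy hQ).1
    · rfl
  · obtain ⟨e₀, he₀⟩ := Finset.nonempty_iff_ne_empty.2 hT
    unfold pinnedCount
    refine Finset.sum_involution (fun y _ => flipOn (splitTouch ends W S) y) ?_ ?_ ?_ ?_
    · intro y _
      by_cases hy : ∀ e, e ∉ S → y e = z e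
      · have hy' := (agree_of_agree (ends := ends) (W := W) y hy).1
        rw [if_pos hy, if_pos hy', flip_splitTouch_comm]
        by_cases hQ : ¬ Conn ends y a₂ a₁ ∧ ¬ Conn ends (flipOn S y) a₂ a₁
        · rw [covW_flip_of_Q hd hX hY y hy hQ.1 hQ.2]; ring
        · obtain ⟨z1, z2⟩ := covW_eq_zero_of_not_Q hd X Y y hy hQ
          rw [z1, z2]; ring
      · have hy' : ¬ ∀ e, e ∉ S → flipOn (splitTouch ends W S) y e = z e := by
          intro h
          apply hy
          intro e he
          rw [← h e he, flipOn_of_notMem _ _ (fun h' => he (mem_splitTouch.1 h').1)]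
        rw [if_neg hy, if_neg hy']; ring
    · intro y _ _ h
      have := congrFun h e₀
      rw [flipOn_of_mem _ _ he₀] at this
      exact Bool.not_ne_self (y e₀) this
    · intro y _; exact Finset.mem_univ _
    · intro y _; exact flipOn_self' _ y

/-- The block of `b`: piece 1 with `X = σ_o − σ₃ 1_{o∈U}` (`o, a₃ ∉ W`) and `Y = σ_b` (`b ∈ W`). -/
theorem pinnedCount_blockTransfer_b {o a₃ b : V} {S : Finset E} {z : Config E}
    (hd : BlockData ends a₁ a₂ W S z) (ho : o ∉ W) (h3 : a₃ ∉ W) (hb : b ∈ W) :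
    pinnedCount S z (covW ends a₁ a₂
      (fun ω => sigma ends a₁ a₂ o ω - sigma ends a₁ a₂ a₃ ω * inU ends a₁ a₂ o ω : Config E → R)
      (sigma ends a₁ a₂ b : Config E → R)) = 0 :=
  pinnedCount_blockTransfer_eq_zero hd
    (wblind_sub (wblind_sigma hd.a₁W hd.a₂W ho)
      (wblind_mul (wblind_sigma hd.a₁W hd.a₂W h3) (wblind_inU hd.a₁W hd.a₂W ho)))
    (wside_sigma hb)

/-- The block of `o` carrying `a₃`: piece 1 with `X = σ_b` (`b ∉ W`) and `Y = σ_o − σ₃ 1_{o∈U}`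
(`o, a₃ ∈ W`). -/
theorem pinnedCount_blockTransfer_o {o a₃ b : V} {S : Finset E} {z : Config E}
    (hd : BlockData ends a₁ a₂ W S z) (ho : o ∈ W) (h3 : a₃ ∈ W) (hb : b ∉ W) :
    pinnedCount S z (covW ends a₁ a₂ (sigma ends a₁ a₂ b : Config E → R)
      (fun ω => sigma ends a₁ a₂ o ω - sigma ends a₁ a₂ a₃ ω * inU ends a₁ a₂ o ω : Config E → R))
      = 0 :=
  pinnedCount_blockTransfer_eq_zero hd (wblind_sigma hd.a₁W hd.a₂W hb)
    (wside_sub (wside_sigma ho) (wside_mul (wside_sigma h3) (wside_inU ho)))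

/-- Piece 2 on the block of `b`: `X = σ₃` (`a₃ ∉ W`), `Y = σ_b` (`b ∈ W`). -/
theorem pinnedCount_blockTransfer_sigma3 {a₃ b : V} {S : Finset E} {z : Config E}
    (hd : BlockData ends a₁ a₂ W S z) (h3 : a₃ ∉ W) (hb : b ∈ W) :
    pinnedCount S z (covW ends a₁ a₂ (sigma ends a₁ a₂ a₃ : Config E → R)
      (sigma ends a₁ a₂ b : Config E → R)) = 0 :=
  pinnedCount_blockTransfer_eq_zero hd (wblind_sigma hd.a₁W hd.a₂W h3) (wside_sigma hb)

end Main

end BlockTransfer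

end CovForm

end Summit.Ventures.PercRepro2
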